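import Summits.QuantumFields.BalabanUV.T4Continuum.E3Cert.ZL2d4DeficitAllU.D_e0
import Summits.QuantumFields.BalabanUV.T4Continuum.E3Cert.ZL2d4DeficitAllU.D_e1
import Summits.QuantumFields.BalabanUV.T4Continuum.E3Cert.ZL2d4DeficitAllU.D_e2
import Summits.QuantumFields.BalabanUV.T4Continuum.E3Cert.ZL2d4DeficitAllU.D_e3
import Summits.QuantumFields.BalabanUV.T4Continuum.E3Cert.ZL2d4DeficitAllU.D_e4
import Summits.QuantumFields.BalabanUV.T4Continuum.E3Cert.ZL2d4DeficitAllU.D_e5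
import Summits.QuantumFields.BalabanUV.T4Continuum.E3Cert.ZL2d4DeficitAllU.D_e6
import Summits.QuantumFields.BalabanUV.T4Continuum.E3Cert.ZL2d4DeficitAllU.D_e7
import Summits.QuantumFields.BalabanUV.T4Continuum.E3Cert.ZL2d4DeficitAllU.D_e8
import Summits.QuantumFields.BalabanUV.T4Continuum.E3Cert.ZL2d4DeficitAllU.D_e9
import Summits.QuantumFields.BalabanUV.T4Continuum.E3Cert.ZL2d4DeficitAllU.D_e10
import Summits.QuantumFields.BalabanUV.T4Continuum.E3Cert.ZL2d4DeficitAllU.D_e11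
import Summits.QuantumFields.BalabanUV.T4Continuum.E3Cert.ZL2d4DeficitAllU.D_e12
import Summits.QuantumFields.BalabanUV.T4Continuum.E3Cert.ZL2d4DeficitAllU.D_e13
import Summits.QuantumFields.BalabanUV.T4Continuum.E3Cert.ZL2d4DeficitAllU.D_e14
import Summits.QuantumFields.BalabanUV.T4Continuum.E3Cert.ZL2d4DeficitAllU.D_e15
import Summits.QuantumFields.BalabanUV.T4Continuum.E3Cert.ZL2d4DeficitAllU.D_e16
import Summits.QuantumFields.BalabanUV.T4Continuum.E3Cert.E3PolyCertZ
/-! E3 certificate package `ZL2d4DeficitAllU` — module `D_e` ((4,2,1) = one L = 2 block in d = 4, SU(2) ≅ S³ links in the quaternion model,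
ALL-U per-link DEFICIT law γ(x) = 1013∕1024 − (241∕1024)·Σ_tΠ_t(1−u₀); emitter `bal_e3_lean_emit.py` output for `block-L2d4-su2-deficit-allU-dyadic.json`,
lane `run/shared/lean/ttrl/balaban-calc/e3/lean-draft/tree/zL2d4DeficitAllU/D_e.lean`; TREE COPY by the substrate cell (E3 hand of record, typer
rulings (μ3)∕(μ3′)∕(μ6), journal l.19196 ∕ l.19672): import prefix substituted and one-line docstrings added BY SCRIPT, no literal touched).  Meaning of
the certificate: see `Data.lean` ∕ `Main.lean` of this package and the checker `E3Cert/E3PolyCertZ*.lean`.  HONEST: certified computation on ONE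
small block — NOT Prop. (1.8), NOT an input of any NE row today, NOT infinite volume ∕ mass gap ∕ Clay. -/
set_option maxRecDepth 200000
set_option maxHeartbeats 0
namespace E3Z
/-- E3 certificate `zL2d4DeficitAllU` component: `zL2d4DeficitAllU_eqs` (lane output, transcribed verbatim; see the module docstring). -/
def zL2d4DeficitAllU_eqs : List (Poly × Poly × Poly) := [zL2d4DeficitAllU_e0, zL2d4DeficitAllU_e1, zL2d4DeficitAllU_e2, zL2d4DeficitAllU_e3, zL2d4DeficitAllU_e4, zL2d4DeficitAllU_e5, zL2d4DeficitAllU_e6, zL2d4DeficitAllU_e7, zL2d4DeficitAllU_e8, zL2d4DeficitAllU_e9, zL2d4DeficitAllU_e10, zL2d4DeficitAllU_e11, zL2d4DeficitAllU_e12, zL2d4DeficitAllU_e13, zL2d4DeficitAllU_e14, zL2d4DeficitAllU_e15, zL2d4DeficitAllU_e16]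
end E3Z
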